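import Summits.QuantumFields.BalabanUV.Beta.GAN24.ChargeTowerLegs

/-!
# `BalabanUV.Beta.GAN24.ChargeTowerStep` — binder row G-an2-4 ∕ (CONV-C), the (S) row ∕ (W-γ) AT EVERY LEVEL («the Δ_j-exact charge tower», road-P2 gen 41, memo
# `HOME/b2b-balaban-gan24-p2/gen41/W-GAMMA-TOWER-v0.md`, step (I1)∘(I2)): **THE SINGLE-COORDINATE CHARGE FUNCTIONS OF THE LEVEL-(j+1) PURE S TABLE ARE THE LEVEL-`j` VERTEX READ
# AGAINST TWO EXIT-SUPPORTED BLOCK-CONSTANT WEIGHTS** — for EVERY bounded `f₁, f₂ : ℤ → ℝ`, every level `j`, every in-block root: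
# `Σ'_{(x′,z′)} f₁(x′_α)·f₂(z′_β)·SpureRecAt ρ … (j+1) κ′ u′ x′ z′ (inl α)(inl β) = (cE·wE_{j+1})·cH_j²·Σ'_{(y,w)} 𝟙^{exit}_α(y)·f₁(⌊y_α∕Lc⌋)·(vertexOfK G_j Lc (SrecAt j) κ′ u′) y w (inl α)(inl β)·𝟙^{exit}_β(w)·f₂(⌊w_β∕Lc⌋)`
# (leaf-02 g52's `CubicPushFaceCharge.hasSum_prod_SpureRecAt_succ_inl_inl` is `f₁ = f₂ ≡ 1`; the classes {1, exit^{Lc}, exit^{Lc²}, …} of the next level ALL pull back to ONE class)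

NOT IN PRINT; OUR BOOKKEEPING ([folklore]: §1 is my g35 `SandwichReadoutSiteDep.hasSum_sandwich_readout_dep` with TWO kernels (left∕right) — proof verbatim, constants `C₁, C₂`; §2 packages
my g41 `CoarseGaugeSourceResponse.tsum_coord_colH ∕ tsum_coord_colM` + leaf-02∕an4's row antisymmetry `CombKernelSheetResponse.coDressKBmAt_KInvStep_inr_inl_eq_neg_colH` + an1's
response-slot multiplier Ward law `KernelWardMColumn.colM_coDressKBmAt_KInvStep_ward_resp` + gan24-leaf-14's `MultiplierZeroMass` off-lattice zeros as the four WEIGHTED coarse-leg charges of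
`G_j`; §3 is leaf-02 g52's `CubicPushFaceCharge` §1–§3 with the weights carried; 0 `def`, 0 cited fact, 0 `def … : Prop`, 0 sorry).  HONEST FRAMING (cell contract, verbatim): «discharging
`BetaPertH` makes Bałaban's UV stability UNCONDITIONAL — a real constructive-QFT result; it is NOT the continuum limit and NOT the Clay problem.»  HONEST DEPENDENCY (verbatim): «continuum YM
on T⁴ ⇐ BetaPertH ∧ nine spine estimates (0/9 proved); BetaPertH ⇐ (D1) ∧ (D4) ∧ CAP+tail; G-an2-4 gates asym, D1 and NE2/3/4.»

* §1–§2 (the two-kernel sandwich Fubini `hasSum_sandwich_readout_two` and the four weighted coarse-leg charges `hasSum_row_coord_inl ∕ _inr`, `hasSum_col_coord_inl ∕ _inr`) are the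
  companion file `GAN24/ChargeTowerLegs.lean` (split for the 400-line rule), used here BY NAME.
* §3 `comp_comp_weighted` (the weights ride through the composition), **`hasSum_prod_coordWeighted_e3OfK_inl_inl`** (any local stencil family `S`),
  **`hasSum_prod_coordWeighted_SpureRecAt_succ_inl_inl`** (the comb S-slot; the rooted border is off the ff block) — THE TOWER STEP.
* §4 **`tsum_weighted_vertexOfK`** (Fubini): the weighted pair charge of the vertex IS the `ℋ`-column read `Σ_κ Σ'_u colH K N κ′ u′ κ u · C^{g₁⊗g₂}(S; κ,u)` of the LOWER charge
  function — the form in which the level-`j` Ward pairing (leaf-06's `RelInvWardPairing.ward_pairing` at `j = 0`) consumes (I3)_j.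
READING.  With road-P2's E28 (kit j166124∕j166535): the charge functions of `SrecAt j` against exit-supported block-constant weights are `Δ_j`-exact up to per-direction constants (slot-
divergence-free to 1e-15 at jb = 0; jb = 1 in the memo), so by leaf-06's Ward pairing at level `j` and `(G_j)_{mm} = E2_{j+1}` the right side above is `Δ_{j+1}`-exact again — the induction
«(I3)_j ⇒ (I3)_{j+1}» runs through THIS identity.  Asserts NO value of Bałaban's tables; discharges NOTHING of (W-γ) ∕ (INV) ∕ (S) ∕ (Q-R) ∕ (LT) ∕ (Q-L) ∕ (C) ∕ «T2Shape» ∕ «T2Drift» ∕ (hW, hWall);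
NEVER «G-an2-4 closed» as (CONV-C); NOT D1, NOT `BetaPertH`, NOT continuum, NOT Clay.  2026-08-22; no existing file touched.
-/

noncomputable section

open Finset
open scoped BigOperators
open Literature.MathematicalPhysics.QuantumFieldTheory
open Literature.MathematicalPhysics.QuantumFieldTheory.Balaban1983to89
open Literature.MathematicalPhysics.QuantumFieldTheory.Balaban1983to89.Beta
open Literature.Probability.LatticeModels (Torus.proj)
open LatticeForm (quo)
open B12Sec2to5 (l1 l1_nonneg summable_exp_neg_l1)
open B6BondElimination (unitVec unitVec_apply)
open ExpKernelCalculus (Site MKer BiLoc Decays comp l1_natSmul l1_sub_triangle l1_sub_symm Zl Zl_nonneg summable_exp_shift summable_exp_shift' tsum_exp_shift tsum_exp_shift')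
open OneStepResolventKernel (Fib LocStencil eq_zsmul_quo_of_proj)
open AffineAveraging (box toSite)
open AveragingContours (blk)
open AxialProjector (blk_zsmul)
open OneStepKernelFamily (KInvStep colH vertexOfK vertexFamily_vertexOfK decays_KInvStep KInvStep_inr_off)
open SecondOrderResponse (colM)
open BalabanStepJetsSucc (mmRead mmRead_inl_inl wE wVH)
open BalabanStepJets (locStencil_mono)
open AveragingHessianKernelsRooted (vhSAt)
open Summit.QuantumFields.BalabanUV.Beta.AxialDressingRooted (coDressKBmAt coDressKBmAt_inr_inr decays_coDressKBmAt)
open Summit.QuantumFields.BalabanUV.Beta.BorderedHessian (stepScale)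
open Summit.QuantumFields.BalabanUV.Beta.SpineRooted (e3OfK e3OfK_apply SpureRecAt SpureRecAt_succ)
open Summit.QuantumFields.BalabanUV.Beta.WardLocusRecursive (SrecAt locStencil_SrecAt)
open Summit.QuantumFields.BalabanUV.Beta.KernelWardMColumn (colM_coDressKBmAt colM_coDressKBmAt_KInvStep_ward_resp)
open Summit.QuantumFields.BalabanUV.Beta.GAN24.KernelLegCharges (summable_exp_coarse)
open Summit.QuantumFields.BalabanUV.Beta.GAN24.ResolventLegCharges (summable_exp_coarse' tsum_exp_coarse_le tsum_exp_coarse_le')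
open Summit.QuantumFields.BalabanUV.Beta.GAN24.MultiplierZeroMass (hasSum_KInvStep_mm_left KInvStep_inr_inr_off_right)
open Summit.QuantumFields.BalabanUV.Beta.GAN24.CombKernelSheetResponse (coDressKBmAt_KInvStep_inr_inl_eq_neg_colH)
open Summit.QuantumFields.BalabanUV.Beta.GAN24.CubicPushFaceCharge (vhSAt_inl_inl)
open Summit.QuantumFields.BalabanUV.Beta.GAN24.CoarseGaugeSourceResponse (summable_bdd_mul tsum_mul_coarseDiv_eq tsum_coord_fibre summable_source_colH summable_source_colM
  tsum_coord_colH tsum_coord_colM)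

open Summit.QuantumFields.BalabanUV.Beta.GAN24.ChargeTowerLegs (summable_legs_prod₂ hasSum_sandwich_readout_two summable_resp_colM
  hasSum_row_coord_inl hasSum_row_coord_inr hasSum_col_coord_inl hasSum_col_coord_inr)

namespace Summit.QuantumFields.BalabanUV.Beta.GAN24.ChargeTowerStep

variable {d : ℕ} {N : ℕ}

section Step

variable {Lc : ℕ} [NeZero Lc] {r : Fin (d + 1) → ℕ}

/-! ## §3 The tower step: single-coordinate charge functions of the co-dressed cubic push -/

/-- [folklore] A weight on the first index rides through a composition on the left. -/
theorem comp_weighted_left (ω : Site (d + 1) → ℝ) (K V : MKer (d + 1) (Fib d)) (x w : Site (d + 1)) (a g : Fib d) :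
    comp (fun p q e f => ω p * K p q e f) V x w a g = ω x * comp K V x w a g := by
  simp only [comp]
  rw [← tsum_mul_left]
  refine tsum_congr fun y => ?_
  rw [Finset.mul_sum]
  exact Finset.sum_congr rfl fun f _ => by ring

/-- [folklore] A weight on the second index rides through a composition on the right. -/
theorem comp_weighted_right (ω : Site (d + 1) → ℝ) (A K : MKer (d + 1) (Fib d)) (x z : Site (d + 1)) (a b : Fib d) :
    comp A (fun p q e f => K p q e f * ω q) x z a b = comp A K x z a b * ω z := by
  simp only [comp]
  rw [← tsum_mul_right]
  refine tsum_congr fun w => ?_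
  rw [Finset.sum_mul]
  exact Finset.sum_congr rfl fun g _ => by ring

/-- [folklore] **THE WEIGHTS RIDE THROUGH THE DOUBLE COMPOSITION**: `((ω₁•K) ∘ V ∘ (K•ω₂))(x,z) = ω₁(x)·ω₂(z)·(K ∘ V ∘ K)(x,z)`. -/
theorem comp_comp_weighted (ω₁ ω₂ : Site (d + 1) → ℝ) (K V : MKer (d + 1) (Fib d)) (x z : Site (d + 1)) (a b : Fib d) :
    comp (comp (fun p q e f => ω₁ p * K p q e f) V) (fun p q e f => K p q e f * ω₂ q) x z a b = ω₁ x * ω₂ z * comp (comp K V) K x z a b := by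
  rw [comp_weighted_right]
  have e : comp (fun p q e f => ω₁ p * K p q e f) V = fun p q e f => ω₁ p * comp K V p q e f := by
    funext p q e f; exact comp_weighted_left ω₁ K V p q e f
  rw [e, comp_weighted_left]
  ring

/-- [folklore] Folding the fibre double sum of §1 at the weighted charges of §2: only `(f, g) = (inl α, inl β)` survives. -/
theorem sum_sum_coord_kron (c a b : ℝ) (V : Fib d → Fib d → ℝ) (α β : Fin (d + 1)) (P Q : Prop) [Decidable P] [Decidable Q] :
    ∑ f : Fib d, ∑ g : Fib d,
        Sum.elim (fun κ : Fin (d + 1) => -(c * (if κ = α ∧ P then a else 0))) (fun _ => (0 : ℝ)) f * V f g *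
          Sum.elim (fun κ : Fin (d + 1) => c * (if κ = β ∧ Q then b else 0)) (fun _ => (0 : ℝ)) g
      = -(c ^ 2 * (if P ∧ Q then a * b * V (Sum.inl α) (Sum.inl β) else 0)) := by
  rw [Fintype.sum_sum_type]
  have hR : ∀ f : Fib d, ∑ g : Fib d, Sum.elim (fun κ : Fin (d + 1) => -(c * (if κ = α ∧ P then a else 0))) (fun _ => (0 : ℝ)) f * V f g *
      Sum.elim (fun κ : Fin (d + 1) => c * (if κ = β ∧ Q then b else 0)) (fun _ => (0 : ℝ)) g
      = Sum.elim (fun κ : Fin (d + 1) => -(c * (if κ = α ∧ P then a else 0))) (fun _ => (0 : ℝ)) f * V f (Sum.inl β) * (c * (if Q then b else 0)) := by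
    intro f
    rw [Fintype.sum_sum_type]
    have h2 : ∑ m : Fin (d + 1), Sum.elim (fun κ : Fin (d + 1) => -(c * (if κ = α ∧ P then a else 0))) (fun _ => (0 : ℝ)) f * V f (Sum.inr m) *
        Sum.elim (fun κ : Fin (d + 1) => c * (if κ = β ∧ Q then b else 0)) (fun _ => (0 : ℝ)) (Sum.inr m) = 0 :=
      Finset.sum_eq_zero fun m _ => by simp only [Sum.elim_inr, mul_zero]
    rw [h2, add_zero, Finset.sum_eq_single β (fun κ _ hκ => ?_) (fun h => absurd (Finset.mem_univ β) h)]
    · simp only [Sum.elim_inl, true_and]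
    · simp only [Sum.elim_inl, if_neg (fun hh : κ = β ∧ Q => hκ hh.1), mul_zero]
  simp only [hR]
  have h3 : ∑ m : Fin (d + 1), Sum.elim (fun κ : Fin (d + 1) => -(c * (if κ = α ∧ P then a else 0))) (fun _ => (0 : ℝ)) (Sum.inr m) * V (Sum.inr m) (Sum.inl β) *
      (c * (if Q then b else 0)) = 0 :=
    Finset.sum_eq_zero fun m _ => by simp only [Sum.elim_inr, zero_mul]
  rw [h3, add_zero, Finset.sum_eq_single α (fun κ _ hκ => ?_) (fun h => absurd (Finset.mem_univ α) h)]
  · simp only [Sum.elim_inl, true_and]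
    by_cases hP : P
    · by_cases hQ : Q
      · rw [if_pos hP, if_pos hQ, if_pos ⟨hP, hQ⟩]; ring
      · rw [if_neg hQ, if_neg (fun hh : P ∧ Q => hQ hh.2)]; ring
    · rw [if_neg hP, if_neg (fun hh : P ∧ Q => hP hh.1)]; ring
  · simp only [Sum.elim_inl, if_neg (fun hh : κ = α ∧ P => hκ hh.1), mul_zero, neg_zero, zero_mul]

/-- NOT IN PRINT; OUR BOOKKEEPING.  **THE TOWER STEP FOR THE CO-DRESSED CUBIC PUSH** (every `j`, in-block root, ANY local stencil family `S`, bounded `f₁ f₂ : ℤ → ℝ`): with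
`G_j = coDressKBmAt ρ Lc (KInvStep Lc j)` and `cH_j = (stepScale_j·Lc^{d+1})⁻¹`,
`HasSum ((x′,z′) ↦ f₁(x′_α)·f₂(z′_β)·e3OfK Lc G_j S κ′ u′ x′ z′ (inl α)(inl β)) (cH_j²·Σ'_{(y,w)} 𝟙[y_α%Lc = Lc−1 ∧ w_β%Lc = Lc−1]·f₁((blk y)_α)·f₂((blk w)_β)·(vertexOfK G_j Lc S κ′ u′) y w (inl α)(inl β))`
— the single-coordinate charge function of the push is its vertex read against the two EXIT-SUPPORTED BLOCK-CONSTANT weights (leaf-02 g52's face form is `f₁ = f₂ ≡ 1`). -/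
theorem hasSum_prod_coordWeighted_e3OfK_inl_inl (hr : r ∈ box (d + 1) Lc) (j : ℕ)
    {S : Fin (d + 1) → Site (d + 1) → MKer (d + 1) (Fib d)} {Cs δs : ℝ} (hS : LocStencil S Cs δs) (hδs : 0 < δs)
    (κ' : Fin (d + 1)) (u' : Site (d + 1)) (α β : Fin (d + 1)) (f₁ f₂ : ℤ → ℝ) {B₁ B₂ : ℝ} (hf₁ : ∀ s, |f₁ s| ≤ B₁) (hf₂ : ∀ s, |f₂ s| ≤ B₂) :
    HasSum (fun xz : Site (d + 1) × Site (d + 1) => f₁ (xz.1 α) * f₂ (xz.2 β) *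
        e3OfK Lc (coDressKBmAt (toSite r) Lc (KInvStep (d := d) Lc j)) S κ' u' xz.1 xz.2 (Sum.inl α) (Sum.inl β))
      ((stepScale d Lc j * (Lc : ℝ) ^ (d + 1))⁻¹ ^ 2 *
        ∑' yw : Site (d + 1) × Site (d + 1),
          (if yw.1 α % (Lc : ℤ) = (Lc : ℤ) - 1 ∧ yw.2 β % (Lc : ℤ) = (Lc : ℤ) - 1 then
            f₁ (blk Lc yw.1 α) * f₂ (blk Lc yw.2 β) *
              vertexOfK (coDressKBmAt (toSite r) Lc (KInvStep (d := d) Lc j)) Lc S κ' u' yw.1 yw.2 (Sum.inl α) (Sum.inl β) else 0)) := by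
  classical
  have hLc : 1 ≤ Lc := Nat.one_le_iff_ne_zero.2 (NeZero.ne Lc)
  set G : MKer (d + 1) (Fib d) := coDressKBmAt (toSite r) Lc (KInvStep (d := d) Lc j) with hGdef
  obtain ⟨δ, C, hδ, -, hK⟩ := decays_KInvStep (d := d) (Lc := Lc) j
  obtain ⟨δG, CG, hδG, hCG, hG⟩ := decays_coDressKBmAt hLc hr (K := KInvStep (d := d) Lc j) ⟨δ, C, hδ, hK.nonneg (Sum.inl 0), hK⟩
  have hCs : 0 ≤ Cs := (hS 0 0).nonneg (Sum.inl 0)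
  set m : ℝ := min δs δG with hm
  have hm0 : 0 < m := lt_min hδs hδG
  have hSm : LocStencil S Cs m := locStencil_mono hS hCs (min_le_left _ _)
  have hV := vertexFamily_vertexOfK (N := Lc) hG hCG hSm hm0 (min_le_right _ _) κ' u'
  have hB₁ : 0 ≤ B₁ := (abs_nonneg _).trans (hf₁ 0)
  have hB₂ : 0 ≤ B₂ := (abs_nonneg _).trans (hf₂ 0)
  -- the two weighted kernels
  set K₁ : MKer (d + 1) (Fib d) := fun p q e f => f₁ (blk Lc p α) * G p q e f with hK₁def
  set K₂ : MKer (d + 1) (Fib d) := fun p q e f => G p q e f * f₂ (blk Lc q β) with hK₂def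
  have hK₁ : Decays K₁ (B₁ * CG) δG := fun p q e f => by
    simp only [hK₁def]
    rw [abs_mul, mul_assoc]
    exact mul_le_mul (hf₁ _) (hG p q e f) (abs_nonneg _) hB₁
  have hK₂ : Decays K₂ (B₂ * CG) δG := fun p q e f => by
    simp only [hK₂def]
    rw [abs_mul, mul_comm, mul_assoc]
    exact mul_le_mul (hf₂ _) (hG p q e f) (abs_nonneg _) hB₂
  -- the weighted coarse-leg charges (§2)
  have hrow : ∀ (f : Fib d) (y : Site (d + 1)), HasSum (fun x' : Site (d + 1) => K₁ ((Lc : ℤ) • x') y (Sum.inr α) f)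
      ((fun (f : Fib d) (y : Site (d + 1)) => Sum.elim (fun κ : Fin (d + 1) => -((stepScale d Lc j * (Lc : ℝ) ^ (d + 1))⁻¹ *
          (if κ = α ∧ y α % (Lc : ℤ) = (Lc : ℤ) - 1 then f₁ (blk Lc y α) else 0))) (fun _ => (0 : ℝ)) f) f y) := by
    intro f y
    have e : ∀ x' : Site (d + 1), K₁ ((Lc : ℤ) • x') y (Sum.inr α) f = f₁ (x' α) * G ((Lc : ℤ) • x') y (Sum.inr α) f := fun x' => by
      simp only [hK₁def, blk_zsmul hLc]
    simp only [e]
    rcases f with κ | m'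
    · exact hasSum_row_coord_inl hr j α f₁ hf₁ y κ
    · exact hasSum_row_coord_inr hr j α f₁ hf₁ y m'
  have hcol : ∀ (g : Fib d) (w : Site (d + 1)), HasSum (fun z' : Site (d + 1) => K₂ w ((Lc : ℤ) • z') g (Sum.inr β))
      ((fun (g : Fib d) (w : Site (d + 1)) => Sum.elim (fun κ : Fin (d + 1) => (stepScale d Lc j * (Lc : ℝ) ^ (d + 1))⁻¹ *
          (if κ = β ∧ w β % (Lc : ℤ) = (Lc : ℤ) - 1 then f₂ (blk Lc w β) else 0)) (fun _ => (0 : ℝ)) g) g w) := by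
    intro g w
    have e : ∀ z' : Site (d + 1), K₂ w ((Lc : ℤ) • z') g (Sum.inr β) = G w ((Lc : ℤ) • z') g (Sum.inr β) * f₂ (z' β) := fun z' => by
      simp only [hK₂def, blk_zsmul hLc]
    simp only [e]
    rcases g with κ | m'
    · exact hasSum_col_coord_inl hr j β f₂ hf₂ w κ
    · exact hasSum_col_coord_inr hr j β f₂ hf₂ w m'
  have h := hasSum_sandwich_readout_two (N := Lc) hK₁ hK₂ hδG hV (half_pos hm0) α β hrow hcol
  simp only [sum_sum_coord_kron] at h
  rw [tsum_neg, tsum_mul_left] at h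
  have h2 := h.neg
  rw [neg_neg] at h2
  refine h2.congr_fun fun xz => ?_
  rw [e3OfK_apply, mmRead_inl_inl, hK₁def, hK₂def, comp_comp_weighted, blk_zsmul hLc, blk_zsmul hLc]
  ring

/-- NOT IN PRINT; OUR BOOKKEEPING.  **THE TOWER STEP FOR THE COMB S-SLOT** (every `j`, in-block root, all `cE cVH cΛ`, bounded `f₁ f₂`): the single-coordinate charge function of member
`j+1` of the pure S table is `(cE·wE_{j+1})·cH_j²` times the level-`j` vertex of `SrecAt j` read against the two exit-supported block-constant weights —
`HasSum ((x′,z′) ↦ f₁(x′_α)·f₂(z′_β)·SpureRecAt ρ cE cVH cΛ (j+1) κ′ u′ x′ z′ (inl α)(inl β))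
   ((cE·wE_{j+1})·(cH_j²·Σ'_{(y,w)} 𝟙[y_α, w_β on exit faces]·f₁((blk y)_α)·f₂((blk w)_β)·(vertexOfK G_j Lc (SrecAt j) κ′ u′) y w (inl α)(inl β)))`
(the rooted border `vhSAt` is off the ff block).  The classes {1, exit^{Lc}, exit^{Lc²}, …} of level `j+1` are `f ∈ {1, 𝟙[· % Lc = Lc−1], 𝟙[· % Lc² = Lc²−1], …}`. -/
theorem hasSum_prod_coordWeighted_SpureRecAt_succ_inl_inl (hr : r ∈ box (d + 1) Lc) (cE cVH cΛ : ℝ) (j : ℕ)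
    (κ' : Fin (d + 1)) (u' : Site (d + 1)) (α β : Fin (d + 1)) (f₁ f₂ : ℤ → ℝ) {B₁ B₂ : ℝ} (hf₁ : ∀ s, |f₁ s| ≤ B₁) (hf₂ : ∀ s, |f₂ s| ≤ B₂) :
    HasSum (fun xz : Site (d + 1) × Site (d + 1) => f₁ (xz.1 α) * f₂ (xz.2 β) *
        SpureRecAt d Lc (toSite r) cE cVH cΛ (j + 1) κ' u' xz.1 xz.2 (Sum.inl α) (Sum.inl β))
      ((cE * wE d Lc (j + 1)) * ((stepScale d Lc j * (Lc : ℝ) ^ (d + 1))⁻¹ ^ 2 *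
        ∑' yw : Site (d + 1) × Site (d + 1),
          (if yw.1 α % (Lc : ℤ) = (Lc : ℤ) - 1 ∧ yw.2 β % (Lc : ℤ) = (Lc : ℤ) - 1 then
            f₁ (blk Lc yw.1 α) * f₂ (blk Lc yw.2 β) *
              vertexOfK (coDressKBmAt (toSite r) Lc (KInvStep (d := d) Lc j)) Lc (SrecAt d Lc (toSite r) cE cVH cΛ j) κ' u' yw.1 yw.2
                (Sum.inl α) (Sum.inl β) else 0))) := by
  have hLc : 1 ≤ Lc := Nat.one_le_iff_ne_zero.2 (NeZero.ne Lc)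
  obtain ⟨Cs, δs, hδs, hS⟩ := locStencil_SrecAt (d := d) (Lc := Lc) hLc hr cE cVH cΛ j
  have h := (hasSum_prod_coordWeighted_e3OfK_inl_inl hr j hS hδs κ' u' α β f₁ f₂ hf₁ hf₂).mul_left (cE * wE d Lc (j + 1))
  refine h.congr_fun fun xz => ?_
  simp only [SpureRecAt_succ, Pi.add_apply, Pi.smul_apply, smul_eq_mul, vhSAt_inl_inl, mul_zero, add_zero]
  ring

/-! ## §4 The vertex form IS the `ℋ`-column read of the lower charge function (Fubini) -/

omit [NeZero Lc] in
/-- [folklore] **UNFOLDING THE VERTEX UNDER TWO BOUNDED WEIGHTS** (any decaying `K`, any local stencil family `S`, bounded `g₁ g₂`, `1 ≤ N`):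
`Σ'_{(y,w)} g₁(y)·(vertexOfK K N S κ′ u′) y w a b·g₂(w) = Σ_κ Σ'_u colH K N κ′ u′ κ u · Σ'_{(y,w)} g₁(y)·g₂(w)·S κ u y w a b` — the weighted pair charge of the vertex is the `ℋ`-COLUMN READ
(source `(κ′,u′)`, response slot `(κ,u)`) of the weighted pair CHARGE FUNCTION `u ↦ C^{g₁⊗g₂}(S; κ,u)` of the stencil family (absolute summability from `Decays K` and `LocStencil S`). -/
theorem tsum_weighted_vertexOfK {N : ℕ} (hN : 1 ≤ N) {K : MKer (d + 1) (Fib d)} {C δ : ℝ} (hK : Decays K C δ) (hδ : 0 < δ)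
    {S : Fin (d + 1) → Site (d + 1) → MKer (d + 1) (Fib d)} {Cs δs : ℝ} (hS : LocStencil S Cs δs) (hδs : 0 < δs)
    (κ' : Fin (d + 1)) (u' : Site (d + 1)) (g₁ g₂ : Site (d + 1) → ℝ) {B₁ B₂ : ℝ} (hg₁ : ∀ y, |g₁ y| ≤ B₁) (hg₂ : ∀ w, |g₂ w| ≤ B₂) (a b : Fib d) :
    ∑' yw : Site (d + 1) × Site (d + 1), g₁ yw.1 * vertexOfK K N S κ' u' yw.1 yw.2 a b * g₂ yw.2
      = ∑ κ, ∑' u : Site (d + 1), colH K N κ' u' κ u * ∑' yw : Site (d + 1) × Site (d + 1), g₁ yw.1 * g₂ yw.2 * S κ u yw.1 yw.2 a b := by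
  classical
  have _ := hN
  have hC : 0 ≤ C := hK.nonneg (Sum.inl 0)
  have hCs : 0 ≤ Cs := (hS 0 0).nonneg (Sum.inl 0)
  have hB₁ : 0 ≤ B₁ := (abs_nonneg _).trans (hg₁ 0)
  have hB₂ : 0 ≤ B₂ := (abs_nonneg _).trans (hg₂ 0)
  -- the family for one direction `κ`, outer index `u`, inner index `(y,w)`
  set F : Fin (d + 1) → Site (d + 1) → Site (d + 1) × Site (d + 1) → ℝ := fun κ u yw =>
    colH K N κ' u' κ u * (g₁ yw.1 * g₂ yw.2 * S κ u yw.1 yw.2 a b) with hF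
  set M : Site (d + 1) → Site (d + 1) × Site (d + 1) → ℝ := fun u yw =>
    (C * Real.exp (-δ * l1 (u - (N : ℤ) • u'))) * ((B₁ * B₂ * Cs) * (Real.exp (-δs * l1 (yw.1 - u)) * Real.exp (-δs * l1 (yw.2 - u)))) with hM
  have hM0 : ∀ u yw, 0 ≤ M u yw := fun u yw => by positivity
  have hFM : ∀ κ u yw, |F κ u yw| ≤ M u yw := by
    intro κ u yw
    simp only [hF, hM]
    rw [abs_mul, abs_mul, abs_mul]
    have e1 : |colH K N κ' u' κ u| ≤ C * Real.exp (-δ * l1 (u - (N : ℤ) • u')) := hK _ _ _ _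
    have e2 := hg₁ yw.1
    have e3 := hg₂ yw.2
    have e4 : |S κ u yw.1 yw.2 a b| ≤ Cs * Real.exp (-δs * (l1 (yw.1 - u) + l1 (yw.2 - u))) := hS κ u yw.1 yw.2 a b
    rw [mul_add, Real.exp_add] at e4
    have h12 : |g₁ yw.1| * |g₂ yw.2| ≤ B₁ * B₂ := mul_le_mul e2 e3 (abs_nonneg _) hB₁
    calc |colH K N κ' u' κ u| * (|g₁ yw.1| * |g₂ yw.2| * |S κ u yw.1 yw.2 a b|)
        ≤ (C * Real.exp (-δ * l1 (u - (N : ℤ) • u'))) * ((B₁ * B₂) * (Cs * (Real.exp (-δs * l1 (yw.1 - u)) * Real.exp (-δs * l1 (yw.2 - u))))) :=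
          mul_le_mul e1 (mul_le_mul h12 e4 (abs_nonneg _) (mul_nonneg hB₁ hB₂)) (by positivity) ((abs_nonneg _).trans e1)
      _ = _ := by ring
  -- the majorant is summable on `Site × (Site × Site)`
  have hMin : ∀ u, HasSum (fun yw => M u yw) ((C * Real.exp (-δ * l1 (u - (N : ℤ) • u'))) * ((B₁ * B₂ * Cs) * (Zl (d + 1) δs * Zl (d + 1) δs))) := by
    intro u
    have h1 := summable_exp_shift' hδs u
    have h2 := summable_exp_shift' hδs u
    have h12 := h1.hasSum.mul h2.hasSum (h1.mul_of_nonneg h2 (fun _ => (Real.exp_pos _).le) (fun _ => (Real.exp_pos _).le))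
    simp only [tsum_exp_shift'] at h12
    exact (h12.mul_left _).mul_left _
  have hMs : Summable (Function.uncurry M) := by
    refine (summable_prod_of_nonneg (fun s => hM0 s.1 s.2)).2 ⟨fun u => (hMin u).summable, ?_⟩
    have e : (fun u => ∑' yw, M u yw) = fun u => (C * ((B₁ * B₂ * Cs) * (Zl (d + 1) δs * Zl (d + 1) δs))) * Real.exp (-δ * l1 (u - (N : ℤ) • u')) := by
      funext u; rw [(hMin u).tsum_eq]; ring
    rw [e]
    exact (summable_exp_shift' hδ _).mul_left _
  have hFs : ∀ κ, Summable (Function.uncurry (F κ)) := fun κ =>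
    Summable.of_norm_bounded hMs (fun s => by rw [Real.norm_eq_abs]; exact hFM κ s.1 s.2)
  -- pointwise: the weighted vertex entry is the `(κ, u)`-sum of `F`
  have hpt : ∀ yw : Site (d + 1) × Site (d + 1), g₁ yw.1 * vertexOfK K N S κ' u' yw.1 yw.2 a b * g₂ yw.2 = ∑ κ, ∑' u, F κ u yw := by
    intro yw
    simp only [vertexOfK, OneStepResolventKernel.wsum, hF]
    rw [Finset.mul_sum, Finset.sum_mul]
    refine Finset.sum_congr rfl fun κ _ => ?_
    rw [← tsum_mul_left, ← tsum_mul_right]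
    exact tsum_congr fun u => by ring
  have hyw : ∀ κ, Summable fun yw : Site (d + 1) × Site (d + 1) => ∑' u : Site (d + 1), F κ u yw := fun κ => by
    have h := (hFs κ).prod_symm.prod
    simpa only [Function.uncurry, Prod.swap] using h
  rw [tsum_congr hpt, Summable.tsum_finsetSum (fun κ _ => hyw κ)]
  refine Finset.sum_congr rfl fun κ _ => ?_
  rw [(hFs κ).tsum_comm]
  refine tsum_congr fun u => ?_
  simp only [hF]
  rw [tsum_mul_left]

end Step

end Summit.QuantumFields.BalabanUV.Beta.GAN24.ChargeTowerStep

end
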